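import Summits.HodgeConjecture.HodgeConjecture.Cruxes.BlochSeedDiscOne.DiamondLevelLaws

/-!
# BlochSeedDiscOne ∕ XPlusServed (v1) — the SERVED FORM of the `X⁺` sibling clause, read on the ORIGINAL configuration

`plan-lens-HodgeAV-control` g14 (director-hodge req-36, LENSES-v3 «control»; crux of record H2 = `stmt-HodgeConjecture-18881` `BlochSeedDiscOne`,
skeleton `Lines/birth.lean` 814a6a70c14e831a, rung `stub_rung_pad4_seedAt` (T_h) = `SeedB1OddDiamondG1H1 h` at `h = 8, 10`; critic of record
idea-crit-6).  Companion memo `CHARGE-INDUCTION-g14.md` (same crux directory), §14.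

WHY.  `CHARGE-INDUCTION-g13.md` §13.6 isolated the one place where `X⁺` must enter the charge induction below the ceiling: the (R4) floor `N`-cells
die (census j318002, ◇₈ `a459e02921a60310` ∕ ◇₁₀ `74004db439790926`) through chains ending in an `X⁺` sibling clause read at an INTERIOR apex pair
(archetype (a): `P[O|4I|O|2ℓ_φ]` with its lowest parent `N[O|4I|O|4I]` and the sibling `P[O|4I|O|2ℓ_ψ]`, slot `f` = the other `4I` unserved above).
`DiamondLevelLaws` reads `X⁺` only at a CEILING apex pair (`xplus_two_children_gen`, `xplus_fork`: the slot `f` carries the ceiling apex `hI`, so the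
`W_f`, (H-b) conditions are vacuous).  This file supplies the GENERAL served form: the clause `XresXFires (C.dual 0) P₁^∨ Z^∨ P₂^∨ g r₁ r₂ f` translated
term by term to the original configuration, every dual-world condition becoming an explicit hypothesis on `N`-cells of `C` (the BREAKERS: raises of
`P₁` at `f`, double raises at `(f, g′)`, lower `r₁`-parents of `P₁`, `r₂`-companions between `P₂` and `Z`, the (H-e′) and (H-b) participants).  In the
charge induction each breaker is absent by an INDUCTION HYPOTHESIS (it has larger maximal top, or the same maximal top and smaller total charge), which
is exactly how the census chains close (memo §14.2).  LAW-FREE, every `h`, no diamond hypothesis.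

HONEST STATUS.  Nothing here proves HC, HC_CM, HC_AV, H2 = `BlochSeedDiscOne`, `stmt-HodgeConjecture-18881`, (T₈), (T₁₀) or any displayed law; HC_CM is
not used.  KERNEL FACTS: `nullBelow_dual0`, `timelike_bsub_comm`, **`xplus_served`** (the served form), `xplus_served_apex` (the apex-pair reading used by
archetype (a)).  No `sorry`, no new axiom, no `instance`, no notation.  Imports `DiamondLevelLaws` only.
-/

namespace Summit.HodgeConjecture.HodgeConjecture.Cruxes.BlochSeedDiscOne.XPlusServed

open Finset Summit.Ventures.HSemireg.Pad4Tower
open Summit.HodgeConjecture.HodgeConjecture.Cruxes.BlochSeedDiscOne.DiamondLevelLaws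

/-- strict null order is reversed by the dual `x ↦ (−α, −β)`. -/
theorem nullBelow_dual0 (x y : BPoint) : NullBelow (dualPt 0 y) (dualPt 0 x) ↔ NullBelow x y := by
  obtain ⟨x1, x2, x3⟩ := x
  obtain ⟨y1, y2, y3⟩ := y
  simp only [NullBelow]
  constructor <;> rintro ⟨h1, h2⟩ <;> exact ⟨by omega, by linear_combination h2⟩

/-- `Timelike` is insensitive to the sign of the offset. -/
theorem timelike_bsub_comm (x y : BPoint) : Timelike (bsub x y) ↔ Timelike (bsub y x) := by
  obtain ⟨x1, x2, x3⟩ := x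
  obtain ⟨y1, y2, y3⟩ := y
  simp only [Timelike]
  constructor <;> intro h <;> nlinarith [h]

/-- **THE SERVED FORM OF THE `X⁺` SIBLING CLAUSE** (KERNEL, law-free, every configuration).  Data, all in `C` itself: a `P`-cell `P₁` (the head) with a
charged letter at `g`; an `N`-cell `Z` of which `P₁` is an `r₁`-partner below at `g` (`UPartner Z P₁ g r₁`) and which is the LOWEST such parent
(`hlow`); a second `P`-cell `P₂`, an `r₂`-partner of `Z` below at `g` with `r₂ ≠ r₁` (the sibling) with no `N`-cell strictly between `P₂` and `Z` on that
leg (`hNC`); a slot `f ≠ g`.  BREAKERS that must be absent ∕ constrained: (W₁) no `N`-cell `P₁(f ↦ y)` with `y` strictly null-above `P₁ f`; (W₂) no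
`N`-cell agreeing with `P₁` off `{f, g′}` raised (strictly, null) at both `f` and `g′`; (H-e′) every `N`-cell `P₁(g ↦ y)`, `y ≠ P₁ g`, with `y` causally
above `P₂ g` and `y − P₁ g` not timelike has `y` causally below `Z g`; (H-b) every `N`-cell agreeing with `P₁` off `{g, f}`, raised (strictly, null) at
`f`, with `g`-letter causally above `P₂ g`, has `g`-letter timelike-related to `P₁ g`.  CONCLUSION: `X⁺`-closure is violated (`False`).  This is
`XresXFires (C.dual 0) P₁^∨ Z^∨ P₂^∨ g r₁ r₂ f` read through `Pad4TowerRuleDMu4Dual` (`uPartner_dual`, `magree_dual`, `ray_dual_iff`, `bsub_dualPt0`). -/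
theorem xplus_served {C : MConfig} (hX : XPlusClosed C) {P₁ Z P₂ : MCell} (hP₁ : P₁ ∈ C.upper) (hZ : Z ∈ C.lower) (hP₂ : P₂ ∈ C.upper)
    {g f r₁ r₂ : Fin 4} (hna : ¬ isApex (P₁ g)) (hfg : f ≠ g) (h1 : UPartner Z P₁ g r₁)
    (hlow : ∀ X ∈ C.lower, UPartner X P₁ g r₁ → (Z g).1 ≤ (X g).1) (hr : r₂ ≠ r₁) (h2 : UPartner Z P₂ g r₂)
    (hNC : ∀ X ∈ C.lower, MAgree X Z g → (P₂ g).1 < (X g).1 → (X g).1 < (Z g).1 → Z g ≠ ray (X g) r₂ ((Z g).1 - (X g).1))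
    (hW₁ : ∀ X ∈ C.lower, MAgree X P₁ f → ¬ NullBelow (P₁ f) (X f))
    (hW₂ : ∀ X ∈ C.lower, ∀ g', g' ≠ f → MAgree2 X P₁ f g' → NullBelow (P₁ f) (X f) → ¬ NullBelow (P₁ g') (X g'))
    (hHe : ∀ X ∈ C.lower, MAgree X P₁ g → X g ≠ P₁ g → Effective (bsub (X g) (P₂ g)) → ¬ Timelike (bsub (P₁ g) (X g)) →
      Effective (bsub (Z g) (X g)))
    (hHb : ∀ X ∈ C.lower, MAgree2 X P₁ g f → NullBelow (P₁ f) (X f) → Effective (bsub (X g) (P₂ g)) → Timelike (bsub (P₁ g) (X g))) :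
    False := by
  refine hX (dualCell 0 P₁) (dualCell_mem_dual_lower hP₁) (dualCell 0 Z) (dualCell_mem_dual_upper hZ) (dualCell 0 P₂)
    (dualCell_mem_dual_lower hP₂) g r₁ r₂ f ⟨?_, hfg, (uPartner_dual 0 Z P₁ g r₁).mpr h1, ?_, hr, ?_, ?_, ?_, ?_, ?_⟩
  · exact fun hap => hna ((isApex_dual 0 (P₁ g)).mp hap)
  · -- lowest parent
    intro P hP hPu
    obtain ⟨X, hXl, rfl⟩ := Finset.mem_image.mp hP
    have := hlow X hXl ((uPartner_dual 0 X P₁ g r₁).mp hPu)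
    show 0 - (X g).1 ≤ 0 - (Z g).1
    omega
  · -- `P₂^∨` is an `r₂`-sibling of `Z^∨`
    exact ⟨magree_dual.mpr (fun j hj => (h2.1 j hj).symm), (ray_dual_iff 0 (Z g) (P₂ g) r₂).mpr ⟨h2.2.1, h2.2.2⟩⟩
  · -- no companion strictly between
    intro P hP hag hlt1 hlt2 hray
    obtain ⟨X, hXl, rfl⟩ := Finset.mem_image.mp hP
    have hag' : MAgree Z X g := magree_dual.mp hag
    obtain ⟨hlt, hZX⟩ := (ray_dual_iff 0 (Z g) (X g) r₂).mp ⟨hlt1, hray⟩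
    have h2' : (P₂ g).1 < (X g).1 := by
      change 0 - (X g).1 < 0 - (P₂ g).1 at hlt2
      omega
    exact hNC X hXl (fun j hj => (hag' j hj).symm) h2' hlt hZX
  · -- (H-e′)
    intro P hP hag hne heff hnt
    obtain ⟨X, hXl, rfl⟩ := Finset.mem_image.mp hP
    have hag' : MAgree P₁ X g := magree_dual.mp hag
    have hne' : X g ≠ P₁ g := fun e => hne (by show dualPt 0 (X g) = dualPt 0 (P₁ g); rw [e])
    rw [show (dualCell 0 P₂) g = dualPt 0 (P₂ g) from rfl, show (dualCell 0 X) g = dualPt 0 (X g) from rfl, bsub_dualPt0] at heff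
    rw [show (dualCell 0 X) g = dualPt 0 (X g) from rfl, show (dualCell 0 P₁) g = dualPt 0 (P₁ g) from rfl, bsub_dualPt0] at hnt
    show Effective (bsub (dualPt 0 (X g)) (dualPt 0 (Z g)))
    rw [bsub_dualPt0]
    exact hHe X hXl (fun j hj => (hag' j hj).symm) hne' heff hnt
  · -- (H-b)
    intro P hP hag hnb heff
    obtain ⟨X, hXl, rfl⟩ := Finset.mem_image.mp hP
    have hag' : MAgree2 P₁ X g f := magree2_dual.mp hag
    have hnb' : NullBelow (P₁ f) (X f) := (nullBelow_dual0 (P₁ f) (X f)).mp hnb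
    rw [show (dualCell 0 P₂) g = dualPt 0 (P₂ g) from rfl, show (dualCell 0 X) g = dualPt 0 (X g) from rfl, bsub_dualPt0] at heff
    show Timelike (bsub (dualPt 0 (X g)) (dualPt 0 (P₁ g)))
    rw [bsub_dualPt0]
    exact hHb X hXl (fun j h1 h2 => (hag' j h1 h2).symm) hnb' heff
  · -- `W_f = ∅`
    intro P hP hnb
    obtain ⟨X, hXl, rfl⟩ := Finset.mem_image.mp hP
    have hnb' : NullBelow (P₁ f) (X f) := (nullBelow_dual0 (P₁ f) (X f)).mp hnb
    refine ⟨fun hag => hW₁ X hXl (fun j hj => ((magree_dual.mp hag) j hj).symm) hnb', fun g' hg' hag2 hnb2 => ?_⟩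
    exact hW₂ X hXl g' hg' (fun j h1 h2 => ((magree2_dual.mp hag2) j h1 h2).symm) hnb'
      ((nullBelow_dual0 (P₁ g') (X g')).mp hnb2)

end Summit.HodgeConjecture.HodgeConjecture.Cruxes.BlochSeedDiscOne.XPlusServed
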